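import Summits.BirchSwinnertonDyer.Rank1Residual.Iwasawa.LambdaInvariantZeroSetTwisted
import Summits.BirchSwinnertonDyer.Rank1Residual.Supersingular.SignedOrderOfVanishing
import HarnessLib

/-!
# Kobayashi's signed `p`-adic `L`-function `L_p^ε` (`a_p = 0`): the conductors `p^{n+e₀}` of parity
# `(−1)ⁿ = ε` carrying a vanishing twist are few — `r + Σ_n φ(pⁿ) ≤ λ(L_p^ε)`, `r + p^{#S} ≤ λ(L_p^ε) + 1`
# — and vanishing is a property of the conductor (classes X6 / X7; `μ`-free; X8 remark)
# (cell `b2b-bsdres`; prover unit `b2b-bsdres-additive-p3` = X8 prover B, X7 joint, gen 8)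

HONEST FRAMING (run/shared/lean/b2b/bsd-rank1-residual/, verbatim in every file): the goal of the
cell is to DELETE the COMBINATION-SHAPED residual classes of the Birch–Swinnerton-Dyer formula for
ALL analytic-rank `≤ 1` elliptic curves over `ℚ` — "full BSD formula for every rank `≤ 1` curve in
class `C`" assembled STRICTLY from published theorems — so that the rank-`≤ 1` remainder becomes
exactly the CONSTRUCTION-SHAPED classes, which are TYPED (missing-input `Prop`s), NOT attempted.
This is not "finishing BSD". X6 / X7 / X8 stay CONSTRUCTION-SHAPED. THEOREMS ONLY on the tree's
real objects (`Kobayashi2003.IsSignedPAdicLFunction`); no named fact; nothing about any curve is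
asserted; nothing booked; no label changes.

## What this file proves

Gen 6 (p217238) showed: `μ = 0` and `λ(L⁻) ≤ p − 2` ⇒ no vanishing twist at ANY odd layer, and the
even analogue. Gen 8 (`Iwasawa/LambdaInvariantZeroSet*.lean`) counts ALL zeros: `λ(G)` is the
number of zeros of `G` in the open unit disc. For `L = L_p^ε` (any `L ∈ Λ` with
`IsSignedPAdicLFunction f p ε L`; Pollack's congruences `θ_n ≡ ±ω_n^∓ L (mod ω_n)` at the levels
`n ≥ 1` with `(−1)ⁿ = ε`) this gives, WITHOUT any `μ` hypothesis:

* §1 `signed_ratTwistedSymbolSum_eq_zero_iff_hasSum_zero`: for `n ≥ 1` of parity `ε` and a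
  primitive even `p`-power-order `χ` of conductor `p^{n+e₀}` (values in `ℂ_p`), the Birch sum
  `∑_a χ(a)[a/p^{n+e₀}]⁺_f` vanishes iff `L(χ(γ) − 1) = 0` (`ω_n^∓(ζ − 1) ≠ 0`, Pollack Lemma 4.7,
  tree theorems); hence `signed_ratTwistedSymbolSum_eq_zero_iff_of_level_eq`: vanishing is a
  property of the conductor (no integral-`θ_n` hypothesis needed: `L` itself is integral).
* §2 `signed_add_sum_totient_le_lam`: `T^r ∣ L ≠ 0`, `S` a finite set of levels `n = k + 1` of
  parity `ε`, each with a vanishing Birch sum of conductor `p^{n+e₀}` ⇒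
  `r + Σ_{k ∈ S} φ(p^{k+1}) ≤ λ(L)`, and `r + p^{#S} ≤ λ(L) + 1`.
* §3 complex side (`f` the newform of `E = W`): the same with `L(E, χ, 1) = 0`
  (`signed_add_sum_totient_le_lam_of_twistedLValue_eq_zero`); with `L(E, 1) = 0` the constant-term
  theorem (Kobayashi (3.6), tree) supplies `r = 1`: `p^{#S} ≤ λ(L_p^ε)`
  (`signed_pow_card_le_lam_of_twistedLValue_eq_zero_of_entireLFunction_one_eq_zero`).

X8 REMARK (`p = 3`, `a_3 = ±3`, Sprung's `L♯/L♭`): there the level-`n` congruence is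
`θ_n ≡ −(u_n L♯ + v_n L♭)` with BOTH `u_n(ζ − 1)`, `v_n(ζ − 1)` non-zero in general (`u_2 = a_p`,
`v_2 = −Φ_p(1+T)`), so a colourwise zero count is not available; X8 rows get the Mazur–Tate form
(`Iwasawa/LambdaInvariantZeroSetTwisted.lean` §5, per layer, `μ`-free) and gen 6's propagation.

References: [Kobayashi2003] Thm. 3.2, (3.4)–(3.6); [Pollack2003] Prop. 6.18, Lemma 4.7;
[Washington1997] §7.1–7.2; [MazurTateTeitelbaum1986Invent] §I.8 (8.6);
HOME/b2b-bsdres-additive-p3/X8-ROUTE-B.md §13 (gen 8).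
-/

set_option autoImplicit false

noncomputable section

open scoped Classical MatrixGroups ModularForm

open CongruenceSubgroup Polynomial WeierstrassCurve Literature.NumberTheory.EllipticCurves
  Literature.NumberTheory.EllipticCurves.ModularForms
  Literature.NumberTheory.EllipticCurves.Kobayashi2003
  Summit.BirchSwinnertonDyer.Rank1Residual.X1.MuLambda
  Summit.BirchSwinnertonDyer.Rank1Residual.Iwasawa

namespace Summit.BirchSwinnertonDyer.Rank1Residual.Supersingular

variable {p : ℕ} [hp : Fact p.Prime] {N : ℕ} {f : CuspForm (Gamma0 N) 2}

/-! ## §1. Birch sums of parity-`ε` conductor vanish exactly at the zeros of `L_p^ε` -/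

section Signed

/-- **The signed congruence evaluated**: for `L` with `IsSignedPAdicLFunction f p ε L`, a level
`k + 1` of parity `ε` (`Even (k+1) ↔ ε = 1`) and a primitive even `p`-power-order `χ` of conductor
`p^{k+1+e₀}`: `∑_a χ(a)[a/p^{k+1+e₀}]⁺_f = c · L(χ(γ) − 1)` with `c = ±ω_{k+1}^∓(χ(γ) − 1) ≠ 0`;
so the Birch sum vanishes iff `L` vanishes at `χ(γ) − 1`.
[cite: Kobayashi2003, Thm. 3.2 and (3.4)–(3.5) (p. 7)] [cite: Pollack2003, Prop. 6.18 and Lemma 4.7] -/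
theorem signed_ratTwistedSymbolSum_eq_zero_iff_hasSum_zero {ε : ℤˣ} {L : IwasawaAlgebra p}
    (hL : IsSignedPAdicLFunction f p ε L) {k : ℕ} (hpar : Even (k + 1) ↔ ε = 1)
    (χ : DirichletCharacter ℂ_[p] (p ^ (k + 1 + cyclotomicExponent p))) (hχ : χ.IsPrimitive)
    (hev : χ.Even) (hord : ∃ j : ℕ, orderOf χ = p ^ j) :
    ratTwistedSymbolSum f χ = 0 ↔
      HasSum (fun i ↦ ((algebraMap ℚ_[p] ℂ_[p]).comp (algebraMap ℤ_[p] ℚ_[p]))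
        (PowerSeries.coeff i L) *
          (χ (cyclotomicGenerator p : ZMod (p ^ (k + 1 + cyclotomicExponent p))) - 1) ^ i) 0 := by
  set ζ : ℂ_[p] := χ (cyclotomicGenerator p : ZMod (p ^ (k + 1 + cyclotomicExponent p))) with hζdef
  have hζ : IsPrimitiveRoot ζ (p ^ (k + 1)) := isPrimitiveRoot_apply_cyclotomicGenerator χ hχ hev hord
  have hz : ‖ζ - 1‖ < 1 := norm_sub_one_lt_one_of_pow_prime_pow_eq_one (j := k + 1) hζ.pow_eq_one
  have hzn : (1 + (ζ - 1)) ^ p ^ (k + 1) = 1 := by rw [add_sub_cancel]; exact hζ.pow_eq_one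
  have hθ := eval₂_mazurTateElement_eq_ratTwistedSymbolSum f χ hev hord
  have hsummable := summable_map_coeff_mul_pow ((algebraMap ℚ_[p] ℂ_[p]).comp
    (algebraMap ℤ_[p] ℚ_[p])) (norm_algebraMap_coeff_le_one L) hz
  have hsign : ((-1 : ℂ_[p]) ^ ((k + 1) / 2 + 1)) ≠ 0 := pow_ne_zero _ (neg_ne_zero.mpr one_ne_zero)
  -- the congruence of parity `ε` at level `k + 1`, evaluated at `ζ - 1`
  have heq : ratTwistedSymbolSum f χ =
      ((-1 : ℂ_[p]) ^ ((k + 1) / 2 + 1) *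
        (if Even (k + 1) then cyclotomicOmegaMinus p (k + 1) else cyclotomicOmegaPlus p (k + 1)).eval₂
          (algebraMap ℤ ℂ_[p]) (ζ - 1)) *
      ∑' i, ((algebraMap ℚ_[p] ℂ_[p]).comp (algebraMap ℤ_[p] ℚ_[p])) (PowerSeries.coeff i L) *
        (ζ - 1) ^ i := by
    rcases Nat.even_or_odd (k + 1) with he | ho
    · have h1 := ((hL.1 (hpar.mp he)) (k + 1) he).eval₂_eq hz hzn
      rw [hθ, eval₂_mul, eval₂_pow, eval₂_neg, eval₂_one] at h1
      rw [if_pos he]; exact h1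
    · have hε : ε = -1 := by
        rcases Int.units_eq_one_or ε with h | h
        · exact absurd (hpar.mpr h) (Nat.not_even_iff_odd.mpr ho)
        · exact h
      have h1 := ((hL.2 hε) (k + 1) ho).eval₂_eq hz hzn
      rw [hθ, eval₂_mul, eval₂_pow, eval₂_neg, eval₂_one] at h1
      rw [if_neg (Nat.not_even_iff_odd.mpr ho)]; exact h1
  have hω : (if Even (k + 1) then cyclotomicOmegaMinus p (k + 1) else cyclotomicOmegaPlus p (k + 1)).eval₂
      (algebraMap ℤ ℂ_[p]) (ζ - 1) ≠ 0 := by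
    split_ifs with he
    · exact eval₂_cyclotomicOmegaMinus_ne_zero he hζ
    · exact eval₂_cyclotomicOmegaPlus_ne_zero (Nat.not_even_iff_odd.mp he) hζ
  constructor
  · intro h0
    rw [h0, eq_comm, mul_eq_zero, mul_eq_zero, or_iff_right hsign, or_iff_right hω] at heq
    rw [← heq]; exact hsummable.hasSum
  · intro hsum
    rw [heq, hsum.tsum_eq, mul_zero]

/-- **Vanishing of a parity-`ε` Birch sum is a property of the CONDUCTOR**: for `L_p^ε` as above
and two primitive even `p`-power-order `χ, χ'` of the same conductor `p^{k+1+e₀}` (`(−1)^{k+1} = ε`),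
`∑ χ(a)[a/p^{k+1+e₀}]⁺_f = 0 ↔ ∑ χ'(a)[a/p^{k+1+e₀}]⁺_f = 0` (both say: `L_p^ε` vanishes on the
Galois orbit of `χ(γ) − 1`; `L_p^ε ∈ Λ` is integral, so no integral-`θ_n` hypothesis is needed).
[cite: Kobayashi2003, Thm. 3.2 and (3.4)–(3.5) (p. 7)] [cite: Washington1997, §7.1–7.2 and Thm. 7.3] -/
theorem signed_ratTwistedSymbolSum_eq_zero_iff_of_level_eq {ε : ℤˣ} {L : IwasawaAlgebra p}
    (hL : IsSignedPAdicLFunction f p ε L) {k : ℕ} (hpar : Even (k + 1) ↔ ε = 1)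
    {χ χ' : DirichletCharacter ℂ_[p] (p ^ (k + 1 + cyclotomicExponent p))} (hχ : χ.IsPrimitive)
    (hev : χ.Even) (hord : ∃ j : ℕ, orderOf χ = p ^ j) (hχ' : χ'.IsPrimitive) (hev' : χ'.Even)
    (hord' : ∃ j : ℕ, orderOf χ' = p ^ j) :
    ratTwistedSymbolSum f χ = 0 ↔ ratTwistedSymbolSum f χ' = 0 := by
  rw [signed_ratTwistedSymbolSum_eq_zero_iff_hasSum_zero hL hpar χ hχ hev hord,
    signed_ratTwistedSymbolSum_eq_zero_iff_hasSum_zero hL hpar χ' hχ' hev' hord']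
  exact hasSum_zero_iff_of_isPrimitiveRoot L
    (isPrimitiveRoot_apply_cyclotomicGenerator χ hχ hev hord)
    (isPrimitiveRoot_apply_cyclotomicGenerator χ' hχ' hev' hord')

/-! ## §2. All vanishing parity-`ε` conductors at once -/

/-- **`r + Σ_{k ∈ S} φ(p^{k+1}) ≤ λ(L_p^ε)`**: for `L_p^ε` (`IsSignedPAdicLFunction f p ε L`), `L ≠ 0`,
`T^r ∣ L`, and a finite set `S` of levels `k + 1` of parity `ε`, each carrying a primitive even
`p`-power-order `χ` of conductor `p^{k+1+e₀}` with vanishing Birch sum. No `μ` hypothesis.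
[cite: Kobayashi2003, Thm. 3.2 and (3.4)–(3.5) (p. 7)] [cite: Washington1997, §7.1–7.2 and Thm. 7.3] -/
theorem signed_add_sum_totient_le_lam {ε : ℤˣ} {L : IwasawaAlgebra p}
    (hL : IsSignedPAdicLFunction f p ε L) (hL0 : L ≠ 0) {r : ℕ}
    (hX : (PowerSeries.X : IwasawaAlgebra p) ^ r ∣ L) (S : Finset ℕ)
    (hS : ∀ k ∈ S, (Even (k + 1) ↔ ε = 1) ∧
      ∃ χ : DirichletCharacter ℂ_[p] (p ^ (k + 1 + cyclotomicExponent p)),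
        χ.IsPrimitive ∧ χ.Even ∧ (∃ j : ℕ, orderOf χ = p ^ j) ∧ ratTwistedSymbolSum f χ = 0) :
    r + ∑ k ∈ S, Nat.totient (p ^ (k + 1)) ≤ lam L := by
  refine add_sum_totient_le_lam_of_X_pow_dvd hL0 hX S fun k hk ↦ ?_
  obtain ⟨hpar, χ, hχ, hev, hord, h0⟩ := hS k hk
  exact ⟨_, isPrimitiveRoot_apply_cyclotomicGenerator χ hχ hev hord,
    (signed_ratTwistedSymbolSum_eq_zero_iff_hasSum_zero hL hpar χ hχ hev hord).mp h0⟩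

/-- **At most `log_p(λ(L_p^ε) − r + 1)` parity-`ε` conductors carry a vanishing Birch sum**:
`r + p^{#S} ≤ λ(L_p^ε) + 1` under the hypotheses of `signed_add_sum_totient_le_lam`.
[cite: Kobayashi2003, Thm. 3.2 and (3.4)–(3.5) (p. 7)] [cite: Washington1997, §7.1–7.2 and Thm. 7.3] -/
theorem signed_add_pow_card_le_lam_succ {ε : ℤˣ} {L : IwasawaAlgebra p}
    (hL : IsSignedPAdicLFunction f p ε L) (hL0 : L ≠ 0) {r : ℕ}
    (hX : (PowerSeries.X : IwasawaAlgebra p) ^ r ∣ L) (S : Finset ℕ)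
    (hS : ∀ k ∈ S, (Even (k + 1) ↔ ε = 1) ∧
      ∃ χ : DirichletCharacter ℂ_[p] (p ^ (k + 1 + cyclotomicExponent p)),
        χ.IsPrimitive ∧ χ.Even ∧ (∃ j : ℕ, orderOf χ = p ^ j) ∧ ratTwistedSymbolSum f χ = 0) :
    r + p ^ S.card ≤ lam L + 1 := by
  have h1 := signed_add_sum_totient_le_lam hL hL0 hX S hS
  have h2 := pow_card_le_one_add_sum_totient (p := p) S
  omega

end Signed

/-! ## §3. Complex side: `L(E, χ, 1) = 0` at few conductors of parity `ε` -/

section Complex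

variable [NeZero N] {W : WeierstrassCurve ℚ} [W.IsElliptic] [W.IsGloballyMinimal]

omit [W.IsElliptic] [W.IsGloballyMinimal] in
/-- **The parity-`ε` conductors with a vanishing twist `L(E, χ, 1) = 0` are few**: `f` the newform
of `E = W`, `L_p^ε` with `IsSignedPAdicLFunction f p ε L`, `L ≠ 0`, `T^r ∣ L`; if every `k ∈ S` has
`(−1)^{k+1} = ε` and a primitive even `p`-power-order `χ` of conductor `p^{k+1+e₀}` with
`L(E, χ, 1) = 0` (any entire continuation), then `r + Σ_{k ∈ S} φ(p^{k+1}) ≤ λ(L)` (Birch's formula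
is a tree theorem; transport `ℂ ↝ ℂ_p` from gen 6). [cite: Kobayashi2003, Thm. 3.2 (p. 7)]
[cite: MazurTateTeitelbaum1986Invent, §I.8 (8.6)] [cite: Washington1997, §7.1–7.2 and Thm. 7.3] -/
theorem signed_add_sum_totient_le_lam_of_twistedLValue_eq_zero (hf : IsNewformOf W f) {ε : ℤˣ}
    {L : IwasawaAlgebra p} (hL : IsSignedPAdicLFunction f p ε L) (hL0 : L ≠ 0) {r : ℕ}
    (hX : (PowerSeries.X : IwasawaAlgebra p) ^ r ∣ L) (S : Finset ℕ)
    (hS : ∀ k ∈ S, (Even (k + 1) ↔ ε = 1) ∧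
      ∃ χ : DirichletCharacter ℂ (p ^ (k + 1 + cyclotomicExponent p)),
        χ.IsPrimitive ∧ χ.Even ∧ (∃ j : ℕ, orderOf χ = p ^ j) ∧ ∃ Lχ : ℂ → ℂ, Differentiable ℂ Lχ ∧
          (∀ s : ℂ, 2 < s.re → Lχ s = twistedLSeries f χ s) ∧ Lχ 1 = 0) :
    r + ∑ k ∈ S, Nat.totient (p ^ (k + 1)) ≤ lam L := by
  refine signed_add_sum_totient_le_lam hL hL0 hX S fun k hk ↦ ?_
  obtain ⟨hpar, χ, hχ, hev, hord, Lχ, hLd, hLχ, h1⟩ := hS k hk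
  haveI : NeZero (p ^ (k + 1 + cyclotomicExponent p)) := ⟨pow_ne_zero _ hp.out.ne_zero⟩
  exact ⟨hpar, exists_padic_ratTwistedSymbolSum_eq_zero_of_twistedLValue_eq_zero hf χ hχ hev hord
    hLd hLχ h1⟩

omit [W.IsElliptic] [W.IsGloballyMinimal] in
/-- **`r + p^{#S} ≤ λ(L_p^ε) + 1`** under the hypotheses of
`signed_add_sum_totient_le_lam_of_twistedLValue_eq_zero`. [cite: Kobayashi2003, Thm. 3.2 (p. 7)]
[cite: Washington1997, §7.1–7.2 and Thm. 7.3] -/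
theorem signed_add_pow_card_le_lam_succ_of_twistedLValue_eq_zero (hf : IsNewformOf W f) {ε : ℤˣ}
    {L : IwasawaAlgebra p} (hL : IsSignedPAdicLFunction f p ε L) (hL0 : L ≠ 0) {r : ℕ}
    (hX : (PowerSeries.X : IwasawaAlgebra p) ^ r ∣ L) (S : Finset ℕ)
    (hS : ∀ k ∈ S, (Even (k + 1) ↔ ε = 1) ∧
      ∃ χ : DirichletCharacter ℂ (p ^ (k + 1 + cyclotomicExponent p)),
        χ.IsPrimitive ∧ χ.Even ∧ (∃ j : ℕ, orderOf χ = p ^ j) ∧ ∃ Lχ : ℂ → ℂ, Differentiable ℂ Lχ ∧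
          (∀ s : ℂ, 2 < s.re → Lχ s = twistedLSeries f χ s) ∧ Lχ 1 = 0) :
    r + p ^ S.card ≤ lam L + 1 := by
  have h1 := signed_add_sum_totient_le_lam_of_twistedLValue_eq_zero hf hL hL0 hX S hS
  have h2 := pow_card_le_one_add_sum_totient (p := p) S
  omega

/-- **`L(E, 1) = 0` (odd `p` good with `a_p = 0`): `p^{#S} ≤ λ(L_p^ε)`** — the zero of `L_p^ε` at
`T = 0` (Kobayashi (3.6): `L_p^ε(0) ∈ {2, p−1}·L(E,1)/Ω⁺ = 0`, tree theorem
`X_dvd_signed_of_entireLFunction_one_eq_zero`) pays one unit. So at a rank-one X6/X7 census pair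
with `λ(L_p^ε) = 1` no conductor of parity `ε` carries a vanishing twist; with `λ = 3` at most one.
[cite: Kobayashi2003, Thm. 3.2 and (3.6) (p. 7)] [cite: Washington1997, §7.1–7.2 and Thm. 7.3] -/
theorem signed_pow_card_le_lam_of_twistedLValue_eq_zero_of_entireLFunction_one_eq_zero
    (hp2 : p ≠ 2) (hf : IsNewformOf W f) (hgood : W.HasGoodReductionAtPrime p)
    (hap : W.frobeniusTrace p = 0) (hL1 : W.entireLFunction 1 = 0) {ε : ℤˣ} {L : IwasawaAlgebra p}
    (hL : IsSignedPAdicLFunction f p ε L) (hL0 : L ≠ 0) (S : Finset ℕ)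
    (hS : ∀ k ∈ S, (Even (k + 1) ↔ ε = 1) ∧
      ∃ χ : DirichletCharacter ℂ (p ^ (k + 1 + cyclotomicExponent p)),
        χ.IsPrimitive ∧ χ.Even ∧ (∃ j : ℕ, orderOf χ = p ^ j) ∧ ∃ Lχ : ℂ → ℂ, Differentiable ℂ Lχ ∧
          (∀ s : ℂ, 2 < s.re → Lχ s = twistedLSeries f χ s) ∧ Lχ 1 = 0) :
    p ^ S.card ≤ lam L := by
  have hX : (PowerSeries.X : IwasawaAlgebra p) ^ 1 ∣ L := by
    rw [pow_one]; exact X_dvd_signed_of_entireLFunction_one_eq_zero hp2 hf hgood hap hL hL1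
  have h := signed_add_pow_card_le_lam_succ_of_twistedLValue_eq_zero hf hL hL0 hX S hS
  omega

omit [W.IsElliptic] [W.IsGloballyMinimal] in
/-- **Rank-0 form (any `L(E,1)`)**: `p^{#S} ≤ λ(L_p^ε) + 1`; in particular a census pair with
`λ(L_p^ε) = 0` (unit `θ`) has NO parity-`ε` conductor with a vanishing twist, and `λ(L_p^ε) = 2`
allows at most one. [cite: Kobayashi2003, Thm. 3.2 (p. 7)] [cite: Washington1997, §7.1–7.2 and Thm. 7.3] -/
theorem signed_pow_card_le_lam_succ_of_twistedLValue_eq_zero (hf : IsNewformOf W f) {ε : ℤˣ}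
    {L : IwasawaAlgebra p} (hL : IsSignedPAdicLFunction f p ε L) (hL0 : L ≠ 0) (S : Finset ℕ)
    (hS : ∀ k ∈ S, (Even (k + 1) ↔ ε = 1) ∧
      ∃ χ : DirichletCharacter ℂ (p ^ (k + 1 + cyclotomicExponent p)),
        χ.IsPrimitive ∧ χ.Even ∧ (∃ j : ℕ, orderOf χ = p ^ j) ∧ ∃ Lχ : ℂ → ℂ, Differentiable ℂ Lχ ∧
          (∀ s : ℂ, 2 < s.re → Lχ s = twistedLSeries f χ s) ∧ Lχ 1 = 0) :
    p ^ S.card ≤ lam L + 1 := by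
  have h := signed_add_pow_card_le_lam_succ_of_twistedLValue_eq_zero hf hL hL0 (r := 0)
    (by rw [pow_zero]; exact one_dvd _) S hS
  simpa using h

end Complex

end Summit.BirchSwinnertonDyer.Rank1Residual.Supersingular

end
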